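import Mathlib
import Summits.ValiantsHypothesis.ValiantsHypothesis.Theorems.RigidityForcesSymmetryRankRigidMinimalReprLaplaceDefs

/-!
# Relabelling slots and letters in a split-rank-one decomposition of the permutation pattern
# (crux `RankRigidMinimalRepr`, stmt-ValiantsHypothesis-18034; frontier rung `LaplaceOptimalFive`, stmt-24813)

The data format of `LaplaceOptimal d` (terms `t ∈ T` with dependence sets `S t`, factors `u t`, `w t`) is transported
by the two symmetries of the pattern `[v injective]`:

* SLOTS (`relabel_slots_*`): for `σ : Equiv.Perm (Fin d)`, the data `S' t = (S t).map σ`, `u' t v = u t (v ∘ σ)`,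
  `w' t v = w t (v ∘ σ)` is again a decomposition (`v ∘ σ` is injective iff `v` is), with the same cardinalities
  `|S' t| = |S t|`, hence the same Laplace weight;
* LETTERS (`relabel_letters_*`): for `τ : Equiv.Perm (Fin d)`, `u' t v = u t (τ ∘ v)`, `w' t v = w t (τ ∘ v)`, same `S`.

These def-free transport lemmas are what a format-level assembly needs to bring an arbitrary configuration to a
canonical representative (as p8 g9's `slotPerm` did at `d = 4`).  General `d`; no new definitions.
HONEST FRAMING: bookkeeping for the frontier rung `LaplaceOptimalFive` (stmt-24813), which stays OPEN; nothing here
bears on `VP ≠ VNP`.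
-/

set_option autoImplicit false

-- the mandated summit-side namespace repeats a component by design (single-problem summit)
set_option linter.dupNamespace false

namespace Summit.ValiantsHypothesis.ValiantsHypothesis.Theorems.RigidityForcesSymmetryRankRigidMinimalRepr

namespace LaplaceRelabel

open Finset

variable {d N : ℕ}

/-! ### §1 Slots -/

/-- Slot relabelling preserves the `u`-locality: `u t (v ∘ σ)` depends only on `v` restricted to `σ(S t)`. -/
theorem relabel_slots_u (σ : Equiv.Perm (Fin d)) (S : Fin N → Finset (Fin d)) (u : Fin N → (Fin d → Fin d) → ℂ)
    (hu : ∀ t, ∀ v v' : Fin d → Fin d, (∀ i ∈ S t, v i = v' i) → u t v = u t v') :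
    ∀ t, ∀ v v' : Fin d → Fin d, (∀ i ∈ (S t).map σ.toEmbedding, v i = v' i) →
      u t (v ∘ σ) = u t (v' ∘ σ) := by
  intro t v v' hvv'
  refine hu t _ _ (fun i hi => ?_)
  simp only [Function.comp_apply]
  exact hvv' (σ i) (Finset.mem_map.mpr ⟨i, hi, rfl⟩)

/-- Slot relabelling preserves the `w`-locality: `w t (v ∘ σ)` depends only on `v` off `σ(S t)`. -/
theorem relabel_slots_w (σ : Equiv.Perm (Fin d)) (S : Fin N → Finset (Fin d)) (w : Fin N → (Fin d → Fin d) → ℂ)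
    (hw : ∀ t, ∀ v v' : Fin d → Fin d, (∀ i, i ∉ S t → v i = v' i) → w t v = w t v') :
    ∀ t, ∀ v v' : Fin d → Fin d, (∀ i, i ∉ (S t).map σ.toEmbedding → v i = v' i) →
      w t (v ∘ σ) = w t (v' ∘ σ) := by
  intro t v v' hvv'
  refine hw t _ _ (fun i hi => ?_)
  simp only [Function.comp_apply]
  refine hvv' (σ i) (fun h => hi ?_)
  obtain ⟨j, hj, hji⟩ := Finset.mem_map.mp h
  have : j = i := σ.injective (by simpa using hji)
  rw [← this]; exact hj

/-- Slot relabelling preserves the decomposition identity. -/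
theorem relabel_slots_sum (σ : Equiv.Perm (Fin d)) (T : Finset (Fin N)) (u w : Fin N → (Fin d → Fin d) → ℂ)
    (hsum : ∀ v : Fin d → Fin d, (∑ t ∈ T, u t v * w t v) = if Function.Injective v then 1 else 0) :
    ∀ v : Fin d → Fin d, (∑ t ∈ T, u t (v ∘ σ) * w t (v ∘ σ)) = if Function.Injective v then 1 else 0 := by
  intro v
  rw [hsum (v ∘ σ)]
  have : Function.Injective (v ∘ σ) ↔ Function.Injective v :=
    ⟨fun h => by
      have := h.comp σ.symm.injective
      simpa [Function.comp_assoc] using this,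
     fun h => h.comp σ.injective⟩
  simp only [this]

/-- Slot relabelling preserves every dependence-set cardinality (hence the Laplace weight). -/
theorem relabel_slots_card (σ : Equiv.Perm (Fin d)) (S : Fin N → Finset (Fin d)) (t : Fin N) :
    ((S t).map σ.toEmbedding).card = (S t).card :=
  Finset.card_map _

/-- **Slot relabelling, packaged**: the Laplace weight of the relabelled data equals the original one. -/
theorem relabel_slots_weight (σ : Equiv.Perm (Fin d)) (T : Finset (Fin N)) (S : Fin N → Finset (Fin d)) :
    (∑ t ∈ T, ((S t).map σ.toEmbedding).card.factorial * (d - ((S t).map σ.toEmbedding).card).factorial) =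
      ∑ t ∈ T, (S t).card.factorial * (d - (S t).card).factorial := by
  simp only [relabel_slots_card]

/-! ### §2 Letters -/

/-- Letter relabelling preserves the `u`-locality. -/
theorem relabel_letters_u (τ : Equiv.Perm (Fin d)) (S : Fin N → Finset (Fin d)) (u : Fin N → (Fin d → Fin d) → ℂ)
    (hu : ∀ t, ∀ v v' : Fin d → Fin d, (∀ i ∈ S t, v i = v' i) → u t v = u t v') :
    ∀ t, ∀ v v' : Fin d → Fin d, (∀ i ∈ S t, v i = v' i) → u t (τ ∘ v) = u t (τ ∘ v') := by
  intro t v v' hvv'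
  exact hu t _ _ (fun i hi => by simp only [Function.comp_apply, hvv' i hi])

/-- Letter relabelling preserves the `w`-locality. -/
theorem relabel_letters_w (τ : Equiv.Perm (Fin d)) (S : Fin N → Finset (Fin d)) (w : Fin N → (Fin d → Fin d) → ℂ)
    (hw : ∀ t, ∀ v v' : Fin d → Fin d, (∀ i, i ∉ S t → v i = v' i) → w t v = w t v') :
    ∀ t, ∀ v v' : Fin d → Fin d, (∀ i, i ∉ S t → v i = v' i) → w t (τ ∘ v) = w t (τ ∘ v') := by
  intro t v v' hvv'
  exact hw t _ _ (fun i hi => by simp only [Function.comp_apply, hvv' i hi])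

/-- Letter relabelling preserves the decomposition identity. -/
theorem relabel_letters_sum (τ : Equiv.Perm (Fin d)) (T : Finset (Fin N)) (u w : Fin N → (Fin d → Fin d) → ℂ)
    (hsum : ∀ v : Fin d → Fin d, (∑ t ∈ T, u t v * w t v) = if Function.Injective v then 1 else 0) :
    ∀ v : Fin d → Fin d, (∑ t ∈ T, u t (τ ∘ v) * w t (τ ∘ v)) = if Function.Injective v then 1 else 0 := by
  intro v
  rw [hsum (τ ∘ v)]
  have : Function.Injective (τ ∘ v) ↔ Function.Injective v :=
    ⟨fun h => Function.Injective.of_comp h, fun h => τ.injective.comp h⟩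
  simp only [this]

end LaplaceRelabel

end Summit.ValiantsHypothesis.ValiantsHypothesis.Theorems.RigidityForcesSymmetryRankRigidMinimalRepr
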